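import Literature.MathematicalPhysics.QuantumFieldTheory.Balaban1983to89.B8Thm32GBoundCubeMemberHolds

/-!
# `Balaban1983to89.B8Thm32GBoundCubeMemberHoldsAll` — [Balaban1985BackgroundPropagators] THEOREM 3.2 (3.48) AT `U = 1` ON THE CUBE MEMBER:
# `GBoundCubeMemberPrinted d ℓ` FOR EVERY `d, ℓ` — the degenerate one-site-block case `L = 1` closed by locality, so that F10's named fact is discharged AS DECLARED

statement-level skeleton of published theorems with citation tags; proofs where landed; nothing here is a claim about the
Yang–Mills mass gap

`[Balaban1985BackgroundPropagators]` ("[4]") Theorem 3.2 (3.48) p. 398, (3.22)–(3.25) p. 394; `[Balaban1984PropagatorsII]` ("B6") (2.14) p. 225 («(Q′₀λ)(x) = λ(x)»);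
`[Balaban1985RegularSpaces]` ("B8") (1.91)–(1.92) p. 91.

CITATION HEADER (lean-in-tree rule).  Cell `pub-ymgap` (YM Track A, HUMAN RULING D-0062), DAG node N05 = [B8], seat `pub-ymgap-dag-n05-c` (g10).  File G3 of this base
(`B8Thm32GBoundCubeMemberHolds.gBoundCubeMemberPrinted_of_one_le`) proves F10's named 𝒢-bound for every `L = ℓ + 1 ≥ 2` (the range of p21's [B6] chain).  F10's
`def GBoundCubeMemberPrinted (d ℓ : ℕ) : Prop` is also meaningful at `ℓ = 0` (`L = 1`): then every block of every level is a single site, the consumer's `Q` is a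
relabelling of sites by towers (`QᵀQ = 1 = QQᵀ`), `(QT⁻¹T⁻¹Qᵀ)⁻¹ = QT²Qᵀ` is LOCAL, and the bound is two row sums of F12 (`(4(d+1)+8)²`; the printed weight sequence
`B6MultiLevelBoxOperator.aPrinted` takes the value `0` at `L = 1` for `j ≥ 1` — a junk value of the closed formula — and `a₀ = 8`, all inside the window `[0, 8]`).
THIS FILE closes that case so that the named fact is a theorem for ALL its parameters: ★ `gBoundCubeMemberPrinted_all (d ℓ : ℕ) : GBoundCubeMemberPrinted d ℓ`.

WHAT THIS FILE PROVES (kernel-checked).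
* §1 `awPrinted_zero_level`, `wPrinted_zero_level` — the printed weights at `L = 1`: `a₀ = 8`, `a_j = 0` (`j ≥ 1`), `w_j = η⁻²a_j`.
* §2 ★ `gBoundCubeMemberPrinted_zero (d) : GBoundCubeMemberPrinted d 0` (constants `C_𝒢 = (4(d+1)+8)²`, `ρ₀ = M₀ = N₀ = 0`).
* §3 ★★ `gBoundCubeMemberPrinted_all (d ℓ : ℕ) : GBoundCubeMemberPrinted d ℓ` (§2 and G3).

HONEST SCOPE ∕ NOT CLAIMED.  The `L = 1` case has no physical content (it is outside print's `L ≥ 2`); it is closed only so that the named fact of F10 is discharged for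
every value of its parameters (the gate's closed-discharge convention; the chair's question (v) on p567362).  Count-neutral; N05 NOT discharged by this file; one finite
`T⁴` programme at fixed `ε`, Bałaban as printed; nothing continuum ∕ ℝ⁴ ∕ OS ∕ mass-gap ∕ Clay.  No `sorry`, no `def`, no `instance`, no `notation`.
Unit `pub-ymgap-dag-n05-c` (g10), 2026-08-27.

RELATED IN THE TREE, NOT DUPLICATED: `B8Thm32GBoundCubeMemberHolds.gBoundCubeMemberPrinted_of_one_le` (G3, USED for `ℓ ≥ 1`), `B8Thm32GBoundCubeMember.GBoundCubeMemberPrinted`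
(F10, the named fact), `B8Eq348CubeMemberKKT.abs_mulVec_le_rowAbs`, `B8Eq348CubeMemberFlatMatrixNorm.flatKernel_rowAbs_le` (USED), `B8Eq191FlatLettersCubeMember.{tower_meets_cube,
towers_disjoint_cube}`, `B8Eq191FlatDirichletConjugation.cover_cubeMember`, `B8Eq191FlatDirichletForm.isUnit_flatMatrix` (USED).
-/
noncomputable section

namespace Literature.MathematicalPhysics.QuantumFieldTheory.Balaban1983to89.B8Thm32GBoundCubeMemberHoldsAll

open scoped Matrix
open B6MultiLevelBoxOperator (levC aPrinted)
open B7Prop1Explicit (e)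
open B8Eq131CubesAdmissible (cubeFam)
open B8CubeMemberZd (cubeLamS)
open B8LambdaSpaceKLevel (wt)
open B8Eq191FlatDirichletForm (isUnit_flatMatrix)
open B8Eq191FlatLettersCubeMember (tower_meets_cube towers_disjoint_cube)
open B8Eq191FlatDirichletConjugation (cover_cubeMember)
open B8Eq348CubeMemberFlatMatrixNorm (flatKernel_rowAbs_le)
open B8Eq1101CubeMemberWeights (awPrinted wPrinted)
open B8Thm32GBoundCubeMember (GBoundCubeMemberPrinted)
open B8Thm32GBoundCubeMemberHolds (gBoundCubeMemberPrinted_of_one_le)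
open B8Eq348CubeMemberKKT (abs_mulVec_le_rowAbs)
open Literature.MathematicalPhysics.QuantumLattice (blockMap)

variable {d : ℕ}

/-! ## §1 The printed weights at `L = 1` -/

/-- At `L = 1` the closed formula of the printed sequence gives `a₀ = 8` and `a_j = 0` for `j ≥ 1` (`aSeq a 1 j = a(1 − 1)∕(1 − 1) = 0`, Lean's `x ∕ 0 = 0`): a junk value of the
formula outside print's `L ≥ 2`, recorded only to close the degenerate case. [cite: Balaban1984PropagatorsII, (2.14) p.225; Balaban1982Higgs1, (2.15) p.609] -/
theorem awPrinted_zero_level (j : ℕ) : awPrinted 0 j = if j = 0 then 8 else 0 := by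
  unfold awPrinted
  by_cases hj : j = 0
  · rw [if_pos hj, if_pos hj]
  · rw [if_neg hj, if_neg hj]
    unfold aPrinted
    rw [B1.aSeq_eq]
    simp

/-- At `L = 1`: `w_j = η⁻²·a_j` (all the level prefactors are `1`). [cite: Balaban1984PropagatorsII, (2.14) p.225] -/
theorem wPrinted_zero_level (d : ℕ) (η : ℝ) (j : ℕ) : wPrinted d 0 η j = (η ^ 2)⁻¹ * awPrinted 0 j := by
  unfold wPrinted levC
  simp

/-! ## §2 The case `L = 1`: every block is a site, `𝒢 = QT²Qᵀ` is local -/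

open Classical in
/-- **THE 𝒢-BOUND AT `L = 1`** (`ℓ = 0`): all blocks are single sites, the consumer's `Q` is a bijective relabelling (`QᵀQ = 1 = QQᵀ`, towers cover `□₀` and are disjoint),
hence `(QT⁻¹T⁻¹Qᵀ)⁻¹ = QT²Qᵀ` and `((QT²Qᵀ)X)_p = (T(T(QᵀX)))(y_p)` with `|QᵀX| ≤ sup|X|`: two row sums of F12 give `η⁴·|(𝒢X)_p| ≤ (4(d+1)+8)²·sup|X|`
(«(Q′₀λ)(x) = λ(x)» at every level).  [cite: Balaban1985BackgroundPropagators, Theorem 3.2 (3.48) p.398, (3.22)–(3.25) p.394; Balaban1984PropagatorsII, (2.14) p.225] -/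
theorem gBoundCubeMemberPrinted_zero (d : ℕ) : GBoundCubeMemberPrinted d 0 := by
  refine ⟨(4 * ((d : ℝ) + 1) + 8) ^ 2, 0, 0, 0, sq_nonneg _, ?_⟩
  intro η hη Mh _hMh _hM0 a M ρ k n R _hn hnk _hρd _hMd hρ0 _hR _hR2 _hRN _hρbig S hS B hB K hK T hT Q hQ X s hs hXs p
  have hd : 0 < d + 1 := Nat.succ_pos d
  have hL : 1 ≤ 0 + 1 := le_rfl
  have hη0 : η ≠ 0 := hη.ne'
  have hρL : 0 + 1 ≤ ρ := hρ0
  -- the weights at `L = 1`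
  have hw0 : ∀ j, 0 ≤ wPrinted d 0 η j := by
    intro j
    rw [wPrinted_zero_level, awPrinted_zero_level]
    split_ifs <;> positivity
  have hamax : ∀ j, j ≤ n → wPrinted d 0 η j * η ^ 2 * ((((0 + 1 : ℕ) : ℝ)) ^ j) ^ 2 * (((((0 + 1 : ℕ) : ℝ)) ^ (d + 1)) ^ j)⁻¹ ≤ 8 := by
    intro j _
    rw [wPrinted_zero_level, awPrinted_zero_level]
    have h8 : (if j = 0 then (8 : ℝ) else 0) ≤ 8 := by split_ifs <;> norm_num
    have hcast : (((0 + 1 : ℕ) : ℝ)) = 1 := by norm_num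
    rw [hcast, one_pow, one_pow, one_pow, one_pow, inv_one, mul_one, mul_one]
    have hη2 : (η ^ 2)⁻¹ * η ^ 2 = 1 := inv_mul_cancel₀ (pow_ne_zero 2 hη0)
    calc (η ^ 2)⁻¹ * (if j = 0 then (8 : ℝ) else 0) * η ^ 2 = ((η ^ 2)⁻¹ * η ^ 2) * (if j = 0 then (8 : ℝ) else 0) := by ring
      _ ≤ 8 := by rw [hη2, one_mul]; exact h8
  -- the unit `T`
  have hTunit : IsUnit T := by rw [hT]; exact isUnit_flatMatrix hd hη0 (0 + 1) n (cubeLamS (0 + 1) a M ρ k n) (wPrinted d 0 η) hw0 K hK S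
  have hT1 : T⁻¹ * T = 1 := Matrix.nonsing_inv_mul T ((Matrix.isUnit_iff_isUnit_det T).mp hTunit)
  -- at `L = 1` every block is a site: the entries of `Q`
  have h1pow : ∀ j : ℕ, (0 + 1) ^ j = 1 := fun j => by simp
  have hbm : ∀ (j : ℕ) (z : Fin (d + 1) → ℤ), blockMap ((0 + 1) ^ j) z = z := fun j z => by
    rw [h1pow]; funext i; simp [blockMap]
  have hc1 : ∀ j : ℕ, (((((0 + 1 : ℕ) : ℝ)) ^ (d + 1))⁻¹) ^ j = 1 := fun j => by simp
  have hQ1 : ∀ (q : ↥B) (z : ↥S), Q q z = if z.1 = q.1.2 then 1 else 0 := by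
    intro q z; rw [hQ, Matrix.of_apply, hbm, hc1]
  -- towers: every site has exactly one, every tower is a site of `□₀`
  have htow : ∀ z : ↥S, ∃ q : ↥B, q.1.2 = z.1 := by
    intro z
    obtain ⟨j, hjn, hzj⟩ := cover_cubeMember hL a M hρL hnk z.1 ((hS z.1).mp z.2)
    rw [hbm] at hzj
    exact ⟨⟨(j, z.1), (hB _).mpr ⟨hjn, hzj⟩⟩, rfl⟩
  have huniq : ∀ (z : ↥S) (q q' : ↥B), q.1.2 = z.1 → q'.1.2 = z.1 → q = q' := by
    intro z q q' h1 h2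
    obtain ⟨hq1, hq2⟩ := (hB q.1).mp q.2
    obtain ⟨hq1', hq2'⟩ := (hB q'.1).mp q'.2
    obtain ⟨hjj, hyy⟩ := towers_disjoint_cube hL a M hρL hnk q.1.1 hq1 q'.1.1 hq1' q.1.2 hq2 q'.1.2 hq2' z.1 ((hS z.1).mp z.2)
      (by rw [hbm]; exact h1.symm) (by rw [hbm]; exact h2.symm)
    exact Subtype.ext (Prod.ext hjj hyy)
  have hsite : ∀ q : ↥B, q.1.2 ∈ S := by
    intro q
    obtain ⟨hq1, hq2⟩ := (hB q.1).mp q.2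
    obtain ⟨z, hz, hzq⟩ := tower_meets_cube hL a M hρL hnk q.1.1 hq1 q.1.2 hq2
    rw [hbm] at hzq
    rw [← hzq]; exact (hS z).mpr hz
  -- `QᵀQ = 1` and `QQᵀ = 1`
  have hQtQ : Qᵀ * Q = 1 := by
    ext z z'
    obtain ⟨q, hq⟩ := htow z
    rw [Matrix.mul_apply, Finset.sum_eq_single q]
    · rw [Matrix.transpose_apply, hQ1, hQ1, if_pos hq.symm, one_mul, hq, Matrix.one_apply]
      by_cases h : z = z'
      · rw [if_pos (by rw [h]), if_pos h]
      · rw [if_neg (fun h' => h (Subtype.ext h'.symm)), if_neg h]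
    · intro q' _ hq'
      rw [Matrix.transpose_apply, hQ1 q' z, if_neg (fun h => hq' (huniq z q' q h.symm hq)), zero_mul]
    · intro h; exact absurd (Finset.mem_univ q) h
  have hQQt : Q * Qᵀ = 1 := by
    ext q q'
    rw [Matrix.mul_apply, Finset.sum_eq_single ⟨q.1.2, hsite q⟩]
    · rw [Matrix.transpose_apply, hQ1, hQ1, if_pos rfl, one_mul, Matrix.one_apply]
      by_cases h : q = q'
      · subst h; rw [if_pos rfl, if_pos rfl]
      · rw [if_neg (fun h' => h (huniq ⟨q.1.2, hsite q⟩ q q' rfl h'.symm)), if_neg h]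
    · intro z _ hz
      rw [hQ1, if_neg (fun h => hz (Subtype.ext h)), zero_mul]
    · intro h; exact absurd (Finset.mem_univ _) h
  -- the inverse of `QT⁻¹T⁻¹Qᵀ` is `QT²Qᵀ`
  have hQtQ' : ∀ W : Matrix ↥S ↥B ℝ, Qᵀ * (Q * W) = W := fun W => by rw [← Matrix.mul_assoc, hQtQ, Matrix.one_mul]
  have hT1' : ∀ W : Matrix ↥S ↥B ℝ, T⁻¹ * (T * W) = W := fun W => by rw [← Matrix.mul_assoc, hT1, Matrix.one_mul]
  have hMinv : (Q * T⁻¹ * T⁻¹ * Qᵀ)⁻¹ = Q * T * T * Qᵀ := by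
    apply Matrix.inv_eq_right_inv
    calc Q * T⁻¹ * T⁻¹ * Qᵀ * (Q * T * T * Qᵀ) = Q * (T⁻¹ * (T⁻¹ * (Qᵀ * (Q * (T * (T * Qᵀ)))))) := by
          simp only [Matrix.mul_assoc]
      _ = 1 := by rw [hQtQ', hT1', hT1', hQQt]
  -- the multiplier is `(T(T(QᵀX)))` at the site of the tower
  have hsum : (∑ p' : ↥B, (Q * T⁻¹ * T⁻¹ * Qᵀ)⁻¹ p p' * X p') = ((Q * T * T * Qᵀ) *ᵥ X) p := by rw [hMinv]; rfl
  rw [hsum]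
  have hv : ∀ z : ↥S, |(Qᵀ *ᵥ X) z| ≤ s := by
    intro z
    obtain ⟨q, hq⟩ := htow z
    rw [Matrix.mulVec, dotProduct, Finset.sum_eq_single q]
    · rw [Matrix.transpose_apply, hQ1, if_pos hq.symm, one_mul]; exact hXs q
    · intro q' _ hq'
      rw [Matrix.transpose_apply, hQ1, if_neg (fun h => hq' (huniq z q' q h.symm hq)), zero_mul]
    · intro h; exact absurd (Finset.mem_univ q) h
  have hrow : ∀ y : ↥S, ∑ z ∈ S, |K y.1 z| ≤ (4 * ((d : ℝ) + 1) + 8) * (η ^ 2)⁻¹ := fun y =>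
    flatKernel_rowAbs_le hL a M hρL hnk hη0 (wPrinted d 0 η) hw0 (by norm_num) hamax S hS K hK y.2
  have h1 : ∀ y : ↥S, |(T *ᵥ (Qᵀ *ᵥ X)) y| ≤ (4 * ((d : ℝ) + 1) + 8) * (η ^ 2)⁻¹ * s := fun y =>
    (abs_mulVec_le_rowAbs S K T hT _ s y (fun z _ => hv z)).trans (mul_le_mul_of_nonneg_right (hrow y) hs)
  have h2 : ∀ y : ↥S, |(T *ᵥ (T *ᵥ (Qᵀ *ᵥ X))) y| ≤ (4 * ((d : ℝ) + 1) + 8) * (η ^ 2)⁻¹ * ((4 * ((d : ℝ) + 1) + 8) * (η ^ 2)⁻¹ * s) :=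
    fun y => (abs_mulVec_le_rowAbs S K T hT _ _ y (fun z _ => h1 z)).trans (mul_le_mul_of_nonneg_right (hrow y) (by positivity))
  have heval : ((Q * T * T * Qᵀ) *ᵥ X) p = (T *ᵥ (T *ᵥ (Qᵀ *ᵥ X))) ⟨p.1.2, hsite p⟩ := by
    rw [show Q * T * T * Qᵀ = Q * (T * (T * Qᵀ)) by simp only [Matrix.mul_assoc], ← Matrix.mulVec_mulVec, ← Matrix.mulVec_mulVec,
      ← Matrix.mulVec_mulVec]
    rw [Matrix.mulVec, dotProduct, Finset.sum_eq_single ⟨p.1.2, hsite p⟩]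
    · rw [hQ1, if_pos rfl, one_mul]
    · intro z _ hz
      rw [hQ1, if_neg (fun h => hz (Subtype.ext h)), zero_mul]
    · intro h; exact absurd (Finset.mem_univ _) h
  rw [heval]
  have hwt : wt (0 + 1) η p.1.1 ^ 4 * (((((0 + 1 : ℕ) : ℝ)) ^ (d + 1)) ^ p.1.1)⁻¹ = (η ^ 2) ^ 2 := by
    unfold wt
    have hcast : (((0 + 1 : ℕ) : ℝ)) = 1 := by norm_num
    rw [hcast, one_pow, one_pow, one_pow, one_mul, inv_one, mul_one]; ring
  rw [hwt]
  have hηη : (η ^ 2) ^ 2 * ((η ^ 2)⁻¹ * (η ^ 2)⁻¹) = 1 := by field_simp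
  calc (η ^ 2) ^ 2 * |(T *ᵥ (T *ᵥ (Qᵀ *ᵥ X))) ⟨p.1.2, hsite p⟩|
      ≤ (η ^ 2) ^ 2 * ((4 * ((d : ℝ) + 1) + 8) * (η ^ 2)⁻¹ * ((4 * ((d : ℝ) + 1) + 8) * (η ^ 2)⁻¹ * s)) :=
        mul_le_mul_of_nonneg_left (h2 _) (by positivity)
    _ = ((η ^ 2) ^ 2 * ((η ^ 2)⁻¹ * (η ^ 2)⁻¹)) * ((4 * ((d : ℝ) + 1) + 8) ^ 2 * s) := by ring
    _ = (4 * ((d : ℝ) + 1) + 8) ^ 2 * s := by rw [hηη, one_mul]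

/-! ## §3 The named fact for every value of its parameters -/

/-- **[Balaban1985BackgroundPropagators] THEOREM 3.2 (3.48) AT `U = 1` ON THE CUBE MEMBER — `GBoundCubeMemberPrinted d ℓ` FOR EVERY `d, ℓ`**: G3's transfer to p21's [B6] Prop. 2.3
for `L = ℓ + 1 ≥ 2`, §2 for the degenerate `L = 1`.  F10's named fact is thereby a theorem for all its parameters. [cite: Balaban1985BackgroundPropagators, Theorem 3.2 (3.48) p.398; Balaban1984PropagatorsII, Prop. 2.3 (2.87) p.238, Lemma 2.1 (2.61) p.234; Balaban1985RegularSpaces, (1.91)–(1.92) p.91] -/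
theorem gBoundCubeMemberPrinted_all (d ℓ : ℕ) : GBoundCubeMemberPrinted d ℓ := by
  rcases Nat.eq_zero_or_pos ℓ with h0 | hpos
  · subst h0; exact gBoundCubeMemberPrinted_zero d
  · exact gBoundCubeMemberPrinted_of_one_le d ℓ hpos

end Literature.MathematicalPhysics.QuantumFieldTheory.Balaban1983to89.B8Thm32GBoundCubeMemberHoldsAll
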